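import Mathlib
import HarnessLib
import Literature.MathematicalPhysics.AQFT.OffDiagonalFlatDecay

/-!
# Taylor flatness of a Schwartz test function at a point outside its support

Stub `stub_flatPoint` of line `Sketch` for crux `SelfNormalisedMomentBoundsR` (item `stmt-QuantumFields-18014`,
route `ScalingWindowSplit` of `QuantumFields/YangMills`).

A real Schwartz function `f` on `E⁴ = EuclideanSpace ℝ (Fin 4)` vanishes identically on the open set
`(tsupport f)ᶜ`, hence so do all its derivatives there (`support_iteratedFDeriv_subset`).  For `z ∉ tsupport f`,
Taylor's theorem along the segment `[z, y]` with vanishing Taylor polynomial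
(`Literature.MathematicalPhysics.AQFT.norm_le_of_iteratedFDeriv_eq_zero`) and the pointwise seminorm bound
`‖D^M f‖ ≤ ‖f‖_{0,M}` (`SchwartzMap.norm_iteratedFDeriv_le_seminorm`) give
`|f y| ≤ ‖f‖_{0,M} ‖y − z‖^M / (M−1)! ≤ ‖f‖_{0,M} ‖y − z‖^M`; the case `M = 0` is `|f y| ≤ ‖f‖_{0,0}`.
-/

open scoped SchwartzMap Nat
open Set

namespace Summit.QuantumFields.YangMills.Theorems.ScalingWindowSplit.SelfNormalisedMomentBoundsR

/-- **Registered stub `stub_flatPoint` (line `Sketch`).**  A real test function is flat at every point outside its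
topological support: `|f y| ≤ ‖f‖_{0,M} ‖y − z‖^M` for `z ∉ tsupport f` (Taylor along the segment `[z, y]`: all
derivatives of `f` vanish at `z`, `‖D^M f‖ ≤ ‖f‖_{0,M}`, and `1/(M−1)! ≤ 1`). [folklore] -/
theorem stub_flatPoint :
    ∀ (M : ℕ) (f : 𝓢(EuclideanSpace ℝ (Fin 4), ℝ)) (y z : EuclideanSpace ℝ (Fin 4)),
      z ∉ tsupport (f : EuclideanSpace ℝ (Fin 4) → ℝ) →
      |f y| ≤ SchwartzMap.seminorm ℝ 0 M f * ‖y - z‖ ^ M := by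
  intro M f y z hz
  rw [← Real.norm_eq_abs]
  cases M with
  | zero =>
    rw [pow_zero, mul_one]
    exact SchwartzMap.norm_le_seminorm ℝ f y
  | succ m =>
    -- all derivatives of `f` vanish at `z ∉ tsupport f`
    have h0 : ∀ k ≤ m, iteratedFDeriv ℝ k (f : EuclideanSpace ℝ (Fin 4) → ℝ) z = 0 :=
      fun k _ => Function.notMem_support.mp fun h => hz (support_iteratedFDeriv_subset k h)
    have h := Literature.MathematicalPhysics.AQFT.norm_le_of_iteratedFDeriv_eq_zero
      (f := (f : EuclideanSpace ℝ (Fin 4) → ℝ)) (x := z) (y := y - z) (M := m)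
      (C := SchwartzMap.seminorm ℝ 0 (m + 1) f)
      (fun t _ => (f.smooth (m + 1)).contDiffAt) h0
      (fun t _ => SchwartzMap.norm_iteratedFDeriv_le_seminorm ℝ f _ _)
    rw [add_sub_cancel] at h
    refine h.trans (div_le_self (by positivity) ?_)
    exact_mod_cast Nat.succ_le_of_lt (Nat.factorial_pos m)

end Summit.QuantumFields.YangMills.Theorems.ScalingWindowSplit.SelfNormalisedMomentBoundsR
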